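/- Free-seat work of LEAD seat `ym-line-cbag-p1` (prover-ym-line-cbag-p1-g22-0; own crux stmt-QuantumFields-22254 closed) on the
planner-of-record's LINE 7, route `GlueballBandRecursion`: the route-posited objects of the planner's BC3 birth skeleton for crux
`OneGlueballBandLower` (stmt-QuantumFields-27506; ideator ym-idea-2 g5, HOME/l7/bc/OneGlueballBandLower_birth.lean, sha16
b152a1e529a0b798, attached as evidence on the item 2026-08-28T10:50Z) VERBATIM, so that its two stubs can be landed by name from
importable, ROUTE-INDEPENDENT definitions (no `Theses` import: pure lattice combinatorics).  Definitions only; nothing is proved here. -/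
import Mathlib

/-!
# Route `GlueballBandRecursion`, crux `OneGlueballBandLower` (stmt-QuantumFields-27506): the objects of the birth skeleton

The crux (K3 of the route): for every compact `G` and faithful unitary lattice representation `r` there are `a > 0`, `L₀` with
`a·N^{3/2}·q_N(β)^{m+2} ≤ x_{m+2}(N)` for `0 ≤ β ≤ strongCouplingRadius r.ρ`, `N ≥ L₀`, `⌊N/4⌋ = m + 2`
(`x_t(N) = traceExcess r.ρ β N t`, `q_N = ⨅ₖ x_{k+2}(N)^{1/(k+2)}`).  The planner's skeleton types it as two stubs over the
objects declared here:

* `momSq N p = Σᵢ min(pᵢ, N − pᵢ)²` — the centred size `|p̃|²` of a torus momentum `p ∈ (Fin N)³`;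
* `bandSum κ N t = Σ_{p ∈ (Fin N)³} exp(−κ·t·momSq N p / N²)` — the Gaussian one-glueball band sum;

stub 1 `stub_bandThermalFloor` (XL, the physics: `q_N^{m+2}·bandSum κ N (m+2) ≤ x_{m+2}(N)` on the strong-coupling window) and
stub 2 `stub_gaussianLatticeCount` (M: `c·N^{3/2} ≤ bandSum κ N ⌊N/4⌋`, sibling file
`GlueballBandRecursionOneGlueballBandLowerGaussianLatticeCount.lean`); the skeleton's kernel-checked composition
`OneGlueballBandLower_of` is the sibling file `GlueballBandRecursionOneGlueballBandLowerSkeleton.lean` (the only one importing the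
route file).  Namespace moved from the skeleton's `…Cruxes.OneGlueballBandLower.Band` to `…Theorems.GlueballBandRecursion.Band`.

HONEST FRAMING.  Declaring these objects proves nothing about the crux; the crux itself, the route's target (the strong-coupling
RUNG `ColdDoublingRecursionStrongCoupling`, RECORD-type) and a fortiori the Yang–Mills mass gap (Clay) are NOT proved here.
-/

set_option autoImplicit false

noncomputable section

namespace Summit.QuantumFields.YangMills.Theorems.GlueballBandRecursion.Band

/-- The centred size `|p̃|² = Σᵢ min(pᵢ, N − pᵢ)²` of a torus momentum `p ∈ (Fin N)³` (an integer) — verbatim the skeleton's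
`momSq`. -/
def momSq (N : ℕ) (p : Fin N × Fin N × Fin N) : ℕ :=
  min p.1.val (N - p.1.val) ^ 2 + min p.2.1.val (N - p.2.1.val) ^ 2 + min p.2.2.val (N - p.2.2.val) ^ 2

/-- The Gaussian band sum `Σ_p exp(−κ t |p̃|²/N²)` over `p ∈ (Fin N)³` — verbatim the skeleton's `bandSum`. -/
def bandSum (κ : ℝ) (N t : ℕ) : ℝ :=
  ∑ p : Fin N × Fin N × Fin N, Real.exp (-(κ * t * (momSq N p : ℝ) / (N : ℝ) ^ 2))

end Summit.QuantumFields.YangMills.Theorems.GlueballBandRecursion.Band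

end
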